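import Summits.KontsevichZagierPeriods.KontsevichZagierPeriods.Theorems.RootDecompQuadraticDescentPair18HomotopyP24

/-! # `RootDecompQuadraticDescentPair18HomotopyP25` — part 25/31 of the mechanical ≤400-line split of `Pair18Homotopy_v14_noguard.lean` (sha256 72e9c8442b4af820…)
Source: decomp-kz lens-6 g9 `Pair18Homotopy.lean` v14 (HOME/decomp-kz-lens-6/g9/, sha256 3dda3232…; critic g4-48/g4-53/g4-56/g5 CLEARED; census pair #18 of crux stmt-KontsevichZagierPeriods-28994: homotopy cells, duplications, inversions, Euler–Landen, arc/angle regions; terminal `pair18_g8strips_of_grid : hEuler → hGrid → hAng4 → (g8 form of #18)`); `#guard_msgs … #print axioms` pins removed for landing.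
Split by census-1 g9 `gen/splitlean.py`: scopes re-opened with their `open`/`variable`/`set_option` context; mathematics and declaration order unchanged. -/

set_option linter.unusedSimpArgs false
noncomputable section
open _root_.Set MvPolynomial
namespace Summit.KontsevichZagierPeriods.RootDecompQuadraticDescent.Pair18Homotopy
open Literature.NumberTheory.Transcendental
open Literature.NumberTheory.Transcendental.KZ (RFun cube)
open Summit.KontsevichZagierPeriods.RootDecompQuadraticDescent.DarkPairs (rel_reflect_rep rel_double)

section Pencil3
open Literature.ModelTheory.ExponentialFields (IsSemialgebraic isSemialgebraic_setOf_eval_le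
  isSemialgebraic_setOf_eval_pos isSemialgebraic_setOf_eval_nonneg isSemialgebraic_setOf_eval_eq_zero)

open _root_.Set MvPolynomial in
open Literature.NumberTheory.Transcendental in
open Literature.NumberTheory.Transcendental.KZ (RFun cube) in
open Summit.KontsevichZagierPeriods.RootDecompQuadraticDescent.DarkPairs (rel_reflect_rep rel_double) in
/-- Auxiliary step `cube2` (§0): cube2. [bookkeeping] -/
private theorem cube2 {x : Fin 2 → ℝ} (hx : x ∈ KZ.cube 2) : (0 ≤ x 0 ∧ x 0 ≤ 1) ∧ (0 ≤ x 1 ∧ x 1 ≤ 1) := ⟨hx 0, hx 1⟩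

/-- **hM2K ⟸ hLog ∧ hAng2.**  With `M2_split` and `M2arc_ang` the `M2`/`K` congruence separates into a
pure LOG-world identity (`2•[M2log] = log²2` against the `g8` log currencies) and a pure ANGLE-world
scissors congruence in the `(P,Q)`-plane with measure `dP dQ/((1+P²)(1+Q²))`
(`2•[Ang|RM] + 4•([Shp]+[Shm]) ≡ 4•[Th7] − 8•[B17]`, i.e. `μ(RM) + μ(R_K) = θ² − 2(π/2−θ)²`). -/
theorem M2K_of_log_ang
    (hLog : 2 • KZ.of M2log.rep - KZ.of N7U + 3 • KZ.of Lbox.rep - 3 • KZ.of Lq.rep - KZ.of MT ∈ KZ.relations)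
    (hAng2 : 2 • KZ.of AngR + 4 • KZ.of Shp.rep + 4 • KZ.of Shm.rep - 4 • KZ.of Th7.rep + 8 • KZ.of B17.rep
      ∈ KZ.relations) :
    2 • KZ.of M2.rep - 4 • KZ.of Shp.rep - 4 • KZ.of Shm.rep + 4 • KZ.of Th7.rep - 8 • KZ.of B17.rep
      - KZ.of N7U + 3 • KZ.of Lbox.rep - 3 • KZ.of Lq.rep - KZ.of MT ∈ KZ.relations := by
  have h := sub_mem (add_mem (sub_mem hLog hAng2) (KZ.relations.nsmul_mem M2_split 2))
    (KZ.relations.nsmul_mem M2arc_ang 2)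
  convert h using 1
  simp only [smul_add, smul_sub, smul_smul]
  abel

/-- **#18 ⟸ hBridge ∧ hLog ∧ hAng2** — the `g9` terminal form: one `ζ(2)`-type ANGLE↔LOG bridge, one
log-world identity, one angle-world scissors congruence (all three classical period identities; see NODE §9.16). -/
theorem pair18_g8strips_of_three
    (hBridge : 6 • KZ.of Ax0.rep - KZ.of Th7.rep - KZ.of B17.rep - 2 • KZ.of PB7.rep ∈ KZ.relations)
    (hLog : 2 • KZ.of M2log.rep - KZ.of N7U + 3 • KZ.of Lbox.rep - 3 • KZ.of Lq.rep - KZ.of MT ∈ KZ.relations)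
    (hAng2 : 2 • KZ.of AngR + 4 • KZ.of Shp.rep + 4 • KZ.of Shm.rep - 4 • KZ.of Th7.rep + 8 • KZ.of B17.rep
      ∈ KZ.relations) :
    KZ.of U1.rep - KZ.of U2r.rep + KZ.of SL.rep - 2 • KZ.of K12c.rep + 2 • KZ.of Kh.rep ∈ KZ.relations :=
  pair18_g8strips_of_bridge_M2K hBridge (M2K_of_log_ang hLog hAng2)

end Pencil3

section KSide
open Literature.ModelTheory.ExponentialFields (IsSemialgebraic isSemialgebraic_setOf_eval_le
  isSemialgebraic_setOf_eval_pos isSemialgebraic_setOf_eval_nonneg isSemialgebraic_setOf_eval_eq_zero)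

/-! ### §18 The K side: `[Shp]`, `[Shm]` as angle–angle boxes (the third and fourth ALGEBRAIC covs)

`ShpDen = x² + xy + 2 = ¼((2x+y)² + Δ)`, `ShmDen = ¼((2x−y)² + Δ)`, `Δ = 8 − y²`.  With
`P = y/√Δ` (`1 + P² = 8/Δ`, `dP/(1+P²) = dy/√Δ`) and `Q = (2x ± y)/√Δ` one has
`½ dx dy/(x² ± xy + 2) = dP dQ/((1+P²)(1+Q²))` EXACTLY — so `[Shp] = μ(RK⁺)`, `[Shm] = μ(RK⁻)` with
`μ` = Lebesgue measure in the angle coordinates `(arctan P, arctan Q)`.  In the normalisation of §17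
(`P = 2s`, `Q = 4w − 2`, `dP dQ = 8 ds dw`) the weight-`1` angle box is
`AngH := [□², 8/((1+4s²)(1+(4w−2)²))]` (`Ang = 2·AngH`), and the maps are
`Ψ_ε(x,y) = ( y/(2√Δ), (2x + εy)/(4√Δ) + ½ )`, `ε = ±1`, `|det DΨ_ε| = 2/Δ²`, image
`RK_ε = {28s² ≤ 1} ∩ {1 + εs ≤ 2w} ∩ {8(2w − 1 − εs)² ≤ 1 + 4s²}`
(= `{7P² ≤ 1, εP ≤ Q, 2(Q − εP)² ≤ 1 + P²}`). -/

/-- Auxiliary definition `KDen` (§18): KDen. [bookkeeping] -/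
def KDen (ε : ℚ) : MvPolynomial (Fin 2) ℚ := C 2 + X 0 * X 0 + C ε * X 1 * X 0
/-- Auxiliary step `KDen_pos` (§18): KDen pos. [bookkeeping] -/
theorem KDen_pos {ε : ℚ} (hε : -1 ≤ ε) {x : Fin 2 → ℝ} (hx : x ∈ KZ.cube 2) : 0 < aeval x (KDen ε) := by
  obtain ⟨h0, h1⟩ := cube2 hx
  have hεR : (-1:ℝ) ≤ (ε:ℝ) := by exact_mod_cast hε
  simp only [map_add, map_sub, map_mul, aeval_C, aeval_X, eq_ratCast, Rat.cast_ofNat, KDen]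
  nlinarith [mul_nonneg (mul_nonneg (show (0:ℝ) ≤ ε + 1 by linarith) h1.1) h0.1,
    mul_nonneg (sub_nonneg.2 h1.2) h0.1, h0.2, mul_nonneg h1.1 h0.1]
/-- `KT ε := [□², ½/(2 + x² + εxy)]` (`KT 1 = Shp`, `KT (−1) = Shm` pointwise). -/
def KT (ε : ℚ) (hε : -1 ≤ ε) : RFun 2 := ⟨C (1 / 2), KDen ε, fun _ hx => (KDen_pos hε hx).ne'⟩

/-- `AngH := [□², 8/((1+4s²)(1+(4w−2)²))]` = `dP dQ/((1+P²)(1+Q²))` in `P = 2s`, `Q = 4w − 2`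
(weight exactly `1` in angle measure; `Ang = 2·AngH`). -/
def AngH : RFun 2 := ⟨C 8, AngDen, fun x _ => (AngDen_pos x).ne'⟩

/-- Auxiliary definition `sK2` (§18): s K2. [bookkeeping] -/
def sK2 : Set (Fin 2 → ℝ) := {z | 28 * z 0 * z 0 ≤ 1}
/-- Auxiliary definition `sK3` (§18): s K3. [bookkeeping] -/
def sK3 (ε : ℚ) : Set (Fin 2 → ℝ) := {z | 1 + (ε:ℝ) * z 0 ≤ 2 * z 1}
/-- Auxiliary definition `sK4` (§18): s K4. [bookkeeping] -/
def sK4 (ε : ℚ) : Set (Fin 2 → ℝ) :=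
  {z | 8 * ((2 * z 1 - 1 - (ε:ℝ) * z 0) * (2 * z 1 - 1 - (ε:ℝ) * z 0)) ≤ 1 + 4 * z 0 * z 0}
/-- the image region `RK_ε`: `7P² ≤ 1`, `εP ≤ Q`, `2(Q − εP)² ≤ 1 + P²` in `P = 2s`, `Q = 4w − 2`. -/
def RK (ε : ℚ) : Set (Fin 2 → ℝ) := cube 2 ∩ (sK2 ∩ sK3 ε ∩ sK4 ε)
/-- Auxiliary step `isSemialgebraic_RK` (§18): is Semialgebraic RK. [bookkeeping] -/
theorem isSemialgebraic_RK (ε : ℚ) : IsSemialgebraic ℚ (RK ε) := by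
  refine KZ.isSemialgebraic_cube.inter (((?_ : IsSemialgebraic ℚ sK2).inter ?_).inter ?_)
  · exact isSemialgebraic_of_le (C 28 * X 0 * X 0) (C 1) sK2 fun z => by
      simp only [sK2, mem_setOf_eq, map_mul, aeval_C, aeval_X, eq_ratCast, Rat.cast_ofNat, Rat.cast_one]
  · exact isSemialgebraic_of_le (C 1 + C ε * X 0) (C 2 * X 1) (sK3 ε) fun z => by
      simp only [sK3, mem_setOf_eq, map_mul, map_add, aeval_C, aeval_X, eq_ratCast, Rat.cast_ofNat,
        Rat.cast_one]
  · exact isSemialgebraic_of_le (C 8 * ((C 2 * X 1 - C 1 - C ε * X 0) * (C 2 * X 1 - C 1 - C ε * X 0)))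
      (C 1 + C 4 * X 0 * X 0) (sK4 ε) fun z => by
      simp only [sK4, mem_setOf_eq, map_mul, map_sub, map_add, aeval_C, aeval_X, eq_ratCast,
        Rat.cast_ofNat, Rat.cast_one]
/-- `[AngH | RK_ε]`. -/
def AngHR (ε : ℚ) : KZ.IntegralRep 2 := AngH.rep.restrict (RK ε) (isSemialgebraic_RK ε) (fun _ hz => hz.1)
/-- `[AngH | RM]` (half of `AngR`). -/
def AngHM : KZ.IntegralRep 2 := AngH.rep.restrict RM isSemialgebraic_RM (fun _ hz => hz.1)
/-- Auxiliary definition `AngHp` (§18): Ang Hp. [bookkeeping] -/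
def AngHp : KZ.IntegralRep 2 := AngHR 1
/-- Auxiliary definition `AngHm` (§18): Ang Hm. [bookkeeping] -/
def AngHm : KZ.IntegralRep 2 := AngHR (-1)

/-- `[Ang | RM] ≡ 2•[AngH | RM]` (rule 1b on the restricted domain). -/
theorem AngR_twice : KZ.of AngR - 2 • KZ.of AngHM ∈ KZ.relations := by
  have h : KZ.of AngR - KZ.of AngHM - KZ.of AngHM ∈ KZ.relations :=
    KZ.integrandAddRel_subset_relations ⟨2, AngR, AngHM, AngHM, rfl, rfl, fun z _ => by
      simp only [AngR, AngHM, KZ.IntegralRep.integrand_restrict, RFun.rep_integrand, Pi.add_apply]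
      simp only [Ang, AngH, RFun.fn, aeval_C, eq_ratCast, Rat.cast_ofNat]
      ring, rfl⟩
  have e : KZ.of AngR - 2 • KZ.of AngHM = KZ.of AngR - KZ.of AngHM - KZ.of AngHM := by
    rw [two_nsmul]; abel
  rw [e]; exact h

/-! #### the algebraic function `s8 y = √(8 − y²)` -/
/-- Auxiliary definition `s8` (§18): s8. [bookkeeping] -/
def s8 (u : ℝ) : ℝ := Real.sqrt (8 - u * u)
/-- Auxiliary step `s8_pos` (§18): s8 pos. [bookkeeping] -/
theorem s8_pos {u : ℝ} (hu : 0 < 8 - u * u) : 0 < s8 u := Real.sqrt_pos.2 hu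
/-- Auxiliary step `s8_sq` (§18): s8 sq. [bookkeeping] -/
theorem s8_sq {u : ℝ} (hu : 0 ≤ 8 - u * u) : s8 u ^ 2 = 8 - u * u := Real.sq_sqrt hu
/-- Auxiliary step `hasDerivAt_s8` (§18): has Deriv At s8. [bookkeeping] -/
theorem hasDerivAt_s8 {u : ℝ} (hu : 0 < 8 - u * u) : HasDerivAt s8 (-u / s8 u) u := by
  have hs := s8_pos hu
  have h := (((hasDerivAt_id' u).fun_mul (hasDerivAt_id' u)).const_sub 8).sqrt hu.ne'
  refine h.congr_deriv ?_
  have hs' : Real.sqrt (8 - u * u) ≠ 0 := by unfold s8 at hs; exact hs.ne'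
  simp only [s8]
  field_simp
  ring
/-- Auxiliary step `hasDerivAt_cK` (§18): has Deriv At c K. [bookkeeping] -/
theorem hasDerivAt_cK {u : ℝ} (hu : 0 < 8 - u * u) :
    HasDerivAt (fun v => v / (2 * s8 v)) (4 / s8 u ^ 3) u := by
  have hs := s8_pos hu
  have hs2 := s8_sq hu.le
  have h := (hasDerivAt_id' u).fun_div ((hasDerivAt_s8 hu).const_mul 2) (by positivity)
  refine h.congr_deriv ?_
  rw [show 4 / s8 u ^ 3 = (2 * s8 u ^ 2 + 2 * u * u) / (4 * s8 u ^ 3) by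
    rw [hs2]; field_simp; ring]
  field_simp
  ring
/-- Auxiliary step `hasDerivAt_gK` (§18): has Deriv At g K. [bookkeeping] -/
theorem hasDerivAt_gK {u : ℝ} (hu : 0 < 8 - u * u) :
    HasDerivAt (fun v => (4 * s8 v)⁻¹) (-(4 * (-u / s8 u)) / (4 * s8 u) ^ 2) u := by
  have hs := s8_pos hu
  exact ((hasDerivAt_s8 hu).const_mul 4).fun_inv (by positivity)

/-- Auxiliary step `K_facts` (§18): K facts. [bookkeeping] -/
theorem K_facts (z : Fin 2 → ℝ) (hz : z ∈ cube 2) :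
    (0 ≤ z 0 ∧ z 0 ≤ 1) ∧ (0 ≤ z 1 ∧ z 1 ≤ 1) ∧ 0 < 8 - z 1 * z 1 ∧ 0 < s8 (z 1) ∧
      s8 (z 1) ^ 2 = 8 - z 1 * z 1 ∧ 3 ≤ 2 * s8 (z 1) := by
  obtain ⟨h0, h1⟩ := cube2 hz
  have hΔ : 0 < 8 - z 1 * z 1 := by nlinarith [mul_nonneg h1.1 (sub_nonneg.2 h1.2)]
  have hs := s8_pos hΔ
  have hs2 := s8_sq hΔ.le
  have h3 : 3 ≤ 2 * s8 (z 1) := by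
    have h4 : (3:ℝ) ^ 2 ≤ (2 * s8 (z 1)) ^ 2 := by
      rw [mul_pow, hs2]; nlinarith [mul_nonneg h1.1 (sub_nonneg.2 h1.2)]
    exact (pow_le_pow_iff_left₀ (by norm_num) (by linarith) two_ne_zero).mp h4
  exact ⟨h0, h1, hΔ, hs, hs2, h3⟩

end KSide
end Summit.KontsevichZagierPeriods.RootDecompQuadraticDescent.Pair18Homotopy
end
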